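import Literature.IUT.LogThetaLattice.PacketLogVolumesHaarModel
import Literature.IUT.LogVolume.TensorPacketCapsuleRegion
import Literature.IUT.LogVolume.LocalDegreeBridge
import Literature.NumberTheory.NumberFields.RescaledCompletion
import HarnessLib

/-!
# [IUTchIII] Proposition 3.9 (iii) at the GENUINE adelic Haar model, capsules `|A| ≥ 2` — I. the nonarchimedean
# tensor packets `⊗_{α∈A} ⊕_{v|p} F_v`: portions, Rmk 3.1.1 (ii)/(iv)-weighted log-volumes, the one-factor law

S. Mochizuki, *Inter-universal Teichmüller theory III*, kurims manuscript (May 2020), §3: Remark 3.1.1 (ii) p. 94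
(the portions `⊗_{α∈A} K_{v_α}` of `log(^A𝓕_{v_ℚ}) = ⊗_{α∈A} ⊕_{v|v_ℚ} log(^α𝓕_v)` and their normalized weights
`1/((Π_α [K_{v_α}:(F_mod)_{v_α}])·Σ_{{w_α}} Π_α [(F_mod)_{w_α}:ℚ_{v_ℚ}])`), (iii)–(iv) pp. 95–97 (direct product regions,
"`E`-weighted" log-volumes), Proposition 3.9 (i) p. 115 (`μ^log_{A,v_ℚ}` on `𝓘^ℚ(^A𝓕_{v_ℚ})`) and (iii) p. 117 ("invariant
with respect to multiplication by elements of `(†𝕄⊛_mod)_α`"). [claim: Mochizuki2012, status: disputed] for every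
[IUTchIII] sentence.

abc-iut cell, layer L6, row «CAP39» (L6-lead §F v1.18h (1); sub-DAG plan/L6/SUBDAG-IUTchIII-Prop-39.md rows iii.r18–r22
at `|A| ≥ 2`; HONEST SCOPE (2) of abc-iut-L6-d3's single-place genuine model `PacketLogVolumesHaarModel.lean`). This is
the first of two files (the second, `PacketLogVolumesHaarModelCapsules.lean`, adds the archimedean packet and the global
assembly). Inputs consumed BY NAME: campaign-S's real tensor packets `PacketAlgebra p k = ⊗_{ℚ_p} k_i` with Mochizuki's
`μ^log = tensorLogVolume` and the one-factor law `tensorLogVolume_iota_smul` (Dupuy–Hilado (3.7); abc-iut-w5-d178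
`TensorPacketCapsuleRegion`: `haar_image_mulLeft_pos/_lt_top`), abc-iut-S7's `RescaledCompletion F p v` (the completion
`F_v` as a normed `ℚ_p`-algebra, `‖·‖' = ‖·‖_v^{1/n_v}`, `norm_of`), and `Σ_{v|p} n_v = [F:ℚ]` (`sum_localDeg`).

WHAT IS TYPED (the case `K = F_mod = F` of d3's file, for an arbitrary finite nonempty label set `A`, at a prime `p`):
the PORTIONS `⊗_{α∈A} F_{v_α}` (`vA : A → V(F)_p`), their admissible regions (positive finite Haar volume), the
Rmk 3.1.1 (iv) log-volume `(Π_α n_{v_α})·μ^log` and the Rmk 3.1.1 (ii) weight `1/[F:ℚ]^{|A|}` (`= packetWeightTensor` at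
`[K_v:(F_mod)_v] = 1`, since `Σ_{{w_α}} Π_α n_{w_α} = [F:ℚ]^{|A|}`); a capsule region at `p` is a direct product region
over the portions, `μ^log_{A,p} := Σ_{vA} (1/[F:ℚ]^{|A|})·(Π_α n_{vA α})·μ^log(T_{vA})`; the action of `f ∈ F^×` THROUGH
THE LABEL `α` is multiplication by `ι_α(f) = 1 ⊗ ⋯ ⊗ f ⊗ ⋯ ⊗ 1` on every portion.
PROVED: **`nonarchCapsuleLogVolume_act`** — `μ^log_{A,p}((α,f)·T) = μ^log_{A,p}(T) + Σ_{v|p} (1/[F:ℚ])·log‖f‖_v`, i.e.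
the capsule packet moves by EXACTLY abc-iut-L6-d3's single-label packet change (one-factor Haar scaling
`padicPortionLogVol_act` + the combinatorial identity `Σ_{vA} Π_{β≠α} n_{vA β}·g(vA α) = [F:ℚ]^{|A|−1}·Σ_v g(v)`).
HONEST SCOPE: `K = F_mod = F`; regions = ALL positive-finite-volume subsets of the portions (a superset of print's
`𝕄(−)`); classical Haar-measure bookkeeping; nothing here constructs `(†𝓕⊛_mod)_α`, asserts anything about
[IUTchIII] Cor. 3.12, or takes a side; typed ≠ endorsed.
-/

noncomputable section

namespace Literature.IUT.LogThetaLattice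

open Literature.IUT.LogVolume Literature.NumberTheory.NumberFields NumberField IsDedekindDomain MeasureTheory Set
open scoped ENNReal NNReal Pointwise

variable (F : Type) [Field F] [NumberField F]
variable (A : Type) [Fintype A] [DecidableEq A] [Nonempty A]

/-! ### §1. The factors `F_v` (`v | p`) as normed `ℚ_p`-algebras and the portions `⊗_{α∈A} F_{v_α}` -/

section Nonarch

variable (p : ℕ) [Fact p.Prime]

omit [NumberField F] in
/-- `v ∈ V(F)_p` ⇒ `p ∈ 𝔭_v`. [cite: NeukirchANT1999, Ch. I §8] -/
theorem natCast_mem_of_mem_placesOver' [NumberField F] {w : HeightOneSpectrum (𝓞 F)} (hw : w ∈ placesOver F p) :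
    ((p : ℕ) : 𝓞 F) ∈ w.asIdeal := by
  have h := (mem_placesOver_iff w).mp hw
  have hmem : (p : ℤ) ∈ w.asIdeal.under ℤ := by
    rw [← h.over]; exact Ideal.mem_span_singleton_self _
  have := Ideal.mem_comap.mp hmem
  simpa using this

/-- The factor `F_v` for `v ∈ V(F)_p`, as abc-iut-S7's rescaled completion (a normed `ℚ_p`-algebra, ultrametric,
proper; the same field and topology as `v.adicCompletion F`). ([IUTchIII] Prop. 3.1 (i): "`K_v`, `v | v_ℚ`".)
[claim: Mochizuki2012, status: disputed] -/
abbrev PadicFactor (w : placesOver F p) : Type := RescaledCompletion F p w.1 (natCast_mem_of_mem_placesOver' F p w.2)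

/-- `f ∈ F` read in the factor `F_v` (through `F ↪ F_v`). [claim: Mochizuki2012, status: disputed] -/
def toPadicFactor (w : placesOver F p) : F →+* PadicFactor F p w :=
  (RescaledCompletion.of F p w.1 (natCast_mem_of_mem_placesOver' F p w.2)).toRingHom.comp
    (NumberField.FinitePlace.embedding w.1)

/-- `‖f‖' = ‖f‖_v^{1/n_v}` in the factor (S7's `norm_of` + Mathlib's `‖(f : F_v)‖ = ‖f‖_v`).
[cite: NeukirchANT1999, Ch. II Thm. (4.8)] -/
theorem norm_toPadicFactor (w : placesOver F p) (f : F) :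
    ‖toPadicFactor F p w f‖ = (NumberField.HeightOneSpectrum.adicAbv F w.1 f : ℝ) ^ (1 / (localDeg F w.1 : ℝ)) := by
  rw [toPadicFactor, RingHom.comp_apply, RingEquiv.toRingHom_eq_coe, RingEquiv.coe_toRingHom,
    RescaledCompletion.norm_of, NumberField.FinitePlace.norm_embedding]

/-- `n_v · log‖f‖' = log‖f‖_v` (`f ≠ 0`). [cite: NeukirchANT1999, Ch. II Thm. (4.8)] -/
theorem localDeg_mul_log_norm_toPadicFactor (w : placesOver F p) {f : F} (hf : f ≠ 0) :
    (localDeg F w.1 : ℝ) * Real.log ‖toPadicFactor F p w f‖ =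
      Real.log (NumberField.HeightOneSpectrum.adicAbv F w.1 f : ℝ) := by
  have hn : (localDeg F w.1 : ℝ) ≠ 0 := by exact_mod_cast (localDeg_pos F w.1).ne'
  have hpos : (0 : ℝ) < NumberField.HeightOneSpectrum.adicAbv F w.1 f :=
    (NumberField.HeightOneSpectrum.adicAbv F w.1).pos hf
  rw [norm_toPadicFactor, Real.log_rpow hpos]
  field_simp

/-- `f ≠ 0 ⇒` its image in `F_v` is nonzero. [claim: Mochizuki2012, status: disputed] -/
theorem toPadicFactor_ne_zero (w : placesOver F p) {f : F} (hf : f ≠ 0) : toPadicFactor F p w f ≠ 0 :=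
  (map_ne_zero (toPadicFactor F p w)).mpr hf

/-- `f ∈ F^×` as a unit of `F_v`. [claim: Mochizuki2012, status: disputed] -/
def unitPadicFactor (w : placesOver F p) (f : Fˣ) : (PadicFactor F p w)ˣ := Units.mk0 (toPadicFactor F p w f) (toPadicFactor_ne_zero F p w f.ne_zero)

/-- The PORTION `⊗_{α∈A} F_{v_α}` of the `A`-tensor packet at `p` indexed by `vA : A → V(F)_p` (Rmk 3.1.1 (ii):
"the topological tensor product … decomposes as a direct sum over collections `{v_α}_{α∈A}`"), as campaign-S's real
tensor packet over `ℚ_p`. [claim: Mochizuki2012, status: disputed] -/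
abbrev PadicPortion (vA : A → placesOver F p) : Type := PacketAlgebra p (fun α => PadicFactor F p (vA α))

/-- Admissible regions of a portion: subsets of POSITIVE FINITE Haar volume (print's "compact subsets of positive
measure" all qualify; Rmk 3.1.1 (iii) p. 95). [claim: Mochizuki2012, status: disputed] -/
def PadicPortionAdm (vA : A → placesOver F p) : Type :=
  {T : Set (PadicPortion F A p vA) //
    0 < (integerStructure p (fun α => PadicFactor F p (vA α))).haar T ∧
      (integerStructure p (fun α => PadicFactor F p (vA α))).haar T < ∞}

/-- The Rmk 3.1.1 (iv) "`E`-weighted" log-volume of a region of the portion `vA`: `(Π_α n_{vA α}) · μ^log(T)` with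
campaign-S's packet-normalised `μ^log = tensorLogVolume` (so that this is the plain Haar log-volume relative to the
tensor product of the integral structures; cf. abc-iut-w5-d178 `prod_deg_mul_tensorLogVolume_capsule`).
[claim: Mochizuki2012, status: disputed] -/
def padicPortionLogVol (vA : A → placesOver F p) (T : Set (PadicPortion F A p vA)) : ℝ :=
  (∏ α, (localDeg F (vA α).1 : ℝ)) * tensorLogVolume p (fun α => PadicFactor F p (vA α)) T

/-- **The action of `f ∈ F^×` through the label `α`** on a portion: multiplication by
`ι_α(f) = 1 ⊗ ⋯ ⊗ f ⊗ ⋯ ⊗ 1`; it keeps positive finite volume (Haar modulus of a unit).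
[claim: Mochizuki2012, status: disputed] -/
def padicPortionAct (vA : A → placesOver F p) (α : A) (f : Fˣ) (T : PadicPortionAdm F A p vA) : PadicPortionAdm F A p vA :=
  ⟨(fun y => iota p (fun β => PadicFactor F p (vA β)) α (unitPadicFactor F p (vA α) f) * y) '' T.1, by
    have hu : (fun y => iota p (fun β => PadicFactor F p (vA β)) α (unitPadicFactor F p (vA α) f) * y) =
        fun y => ((iotaUnits p (fun β => PadicFactor F p (vA β)) α (unitPadicFactor F p (vA α) f) :
          (PadicPortion F A p vA)ˣ) : PadicPortion F A p vA) * y := by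
      funext y; rw [coe_iotaUnits]
    rw [hu]
    exact ⟨haar_image_mulLeft_pos p _ _ T.2.1, haar_image_mulLeft_lt_top p _ _ T.2.2⟩⟩

/-- Underlying set of `(α,f)·T`. [claim: Mochizuki2012, status: disputed] -/
@[simp] theorem padicPortionAct_val (vA : A → placesOver F p) (α : A) (f : Fˣ) (T : PadicPortionAdm F A p vA) :
    (padicPortionAct F A p vA α f T).1 =
      (fun y => iota p (fun β => PadicFactor F p (vA β)) α (unitPadicFactor F p (vA α) f) * y) '' T.1 := rfl

/-- **One-factor scaling in a portion** (Dupuy–Hilado (3.7) / [AbsTopIII] Prop. 5.7 (i)(b), via campaign-S's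
`tensorLogVolume_iota_smul`): `(Π n)·μ^log(ι_α(f)·T) = (Π n)·μ^log(T) + (Π_{β≠α} n_{vA β})·log‖f‖_{vA α}`.
[cite: DupuyHilado2025, §3.7] -/
theorem padicPortionLogVol_act (vA : A → placesOver F p) (α : A) (f : Fˣ) (T : PadicPortionAdm F A p vA) :
    padicPortionLogVol F A p vA (padicPortionAct F A p vA α f T).1 =
      padicPortionLogVol F A p vA T.1 +
        (∏ β ∈ Finset.univ.erase α, (localDeg F (vA β).1 : ℝ)) *
          Real.log (NumberField.HeightOneSpectrum.adicAbv F (vA α).1 (f : F) : ℝ) := by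
  have hlog : (localDeg F (vA α).1 : ℝ) *
      Real.log ‖((unitPadicFactor F p (vA α) f : (PadicFactor F p (vA α))ˣ) : PadicFactor F p (vA α))‖ =
        Real.log (NumberField.HeightOneSpectrum.adicAbv F (vA α).1 (f : F) : ℝ) :=
    localDeg_mul_log_norm_toPadicFactor F p (vA α) f.ne_zero
  rw [padicPortionLogVol, padicPortionAct_val, tensorLogVolume_iota_smul p _ α _ T.2.1 T.2.2, padicPortionLogVol, mul_add,
    ← hlog, ← Finset.prod_erase_mul Finset.univ (fun β => (localDeg F (vA β).1 : ℝ)) (Finset.mem_univ α)]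
  ring

/-! ### §2. The capsule packet at `p`: direct product regions over the portions, Rmk 3.1.1 (ii) weights -/

/-- A CAPSULE REGION at `p`: one admissible region in every portion `vA : A → V(F)_p` (a direct product region
over the portions of `𝓘^ℚ(^A𝓕_p)`, Rmk 3.1.1 (iii)). [claim: Mochizuki2012, status: disputed] -/
def NonarchCapsuleRegion : Type := ∀ vA : A → placesOver F p, PadicPortionAdm F A p vA

/-- The Rmk 3.1.1 (ii) normalized weight for `K = F_mod = F`: `1/[F:ℚ]^{|A|}`
(`= 1/Σ_{{w_α}} Π_α [F_{w_α}:ℚ_p]`, as `Σ_{w|p} [F_w:ℚ_p] = [F:ℚ]`; the same at every portion).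
[claim: Mochizuki2012, status: disputed] -/
def haarCapsuleWeight : ℝ := 1 / (Module.finrank ℚ F : ℝ) ^ Fintype.card A

/-- **`μ^log_{A,p}`** on capsule regions: the Rmk 3.1.1 (ii)/(iv) weighted sum over the portions.
[claim: Mochizuki2012, status: disputed] -/
def nonarchCapsuleLogVolume (T : NonarchCapsuleRegion F A p) : ℝ :=
  ∑ vA : A → placesOver F p, haarCapsuleWeight F A * padicPortionLogVol F A p vA (T vA).1

/-- The action of `f` through the label `α` on capsule regions at `p` (portionwise). [claim: Mochizuki2012, status: disputed] -/
def nonarchCapsuleAct (α : A) (f : Fˣ) (T : NonarchCapsuleRegion F A p) : NonarchCapsuleRegion F A p :=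
  fun vA => padicPortionAct F A p vA α f (T vA)

omit [Nonempty A] in
/-- **The combinatorial identity behind the regrouping** (Rmk 3.1.1 (ii)): for `g : V(F)_p → ℝ`,
`Σ_{vA : A → V(F)_p} (Π_{β≠α} n_{vA β})·g(vA α) = [F:ℚ]^{|A|−1} · Σ_{v|p} g(v)`.
[cite: NeukirchANT1999, Ch. II Prop. (8.5)] -/
theorem sum_prod_erase_localDeg_mul (α : A) (g : placesOver F p → ℝ) :
    ∑ vA : A → placesOver F p, (∏ β ∈ Finset.univ.erase α, (localDeg F (vA β).1 : ℝ)) * g (vA α) =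
      (Module.finrank ℚ F : ℝ) ^ (Fintype.card A - 1) * ∑ w : placesOver F p, g w := by
  classical
  -- split `vA ↦ (vA α, vA|_{β ≠ α})`
  have step1 : ∑ vA : A → placesOver F p, (∏ β ∈ Finset.univ.erase α, (localDeg F (vA β).1 : ℝ)) * g (vA α) =
      ∑ x : placesOver F p × ({β : A // β ≠ α} → placesOver F p),
        (∏ β : {β : A // β ≠ α}, (localDeg F (x.2 β).1 : ℝ)) * g x.1 := by
    refine Fintype.sum_equiv (Equiv.piSplitAt α fun _ : A => placesOver F p) _ _ fun vA => ?_
    rw [Finset.prod_subtype (Finset.univ.erase α) (p := fun β : A => β ≠ α)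
      (fun β => by simp [Finset.mem_erase])]
    rfl
  -- sum the product of the free coordinates: `Σ_r Π_β n(r β) = Π_β Σ_w n(w) = [F:ℚ]^{|A|−1}`
  have step2 : ∑ r : {β : A // β ≠ α} → placesOver F p, ∏ β : {β : A // β ≠ α}, (localDeg F (r β).1 : ℝ) =
      (Module.finrank ℚ F : ℝ) ^ (Fintype.card A - 1) := by
    rw [← Fintype.piFinset_univ, Finset.sum_prod_piFinset Finset.univ
      (fun (_ : {β : A // β ≠ α}) (w : placesOver F p) => (localDeg F w.1 : ℝ)), Finset.prod_const,
      Finset.card_univ]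
    congr 1
    · rw [Finset.sum_coe_sort (placesOver F p) (fun w => (localDeg F w : ℝ))]
      exact_mod_cast sum_localDeg F p
    · rw [Fintype.card_subtype_compl, Fintype.card_subtype_eq]
  rw [step1, Fintype.sum_prod_type]
  simp_rw [← Finset.sum_mul]
  rw [step2, Finset.mul_sum]

/-- `Σ_{vA} (1/[F:ℚ]^{|A|})·(Π_{β≠α} n_{vA β})·g(vA α) = (1/[F:ℚ])·Σ_{v|p} g(v)`. [cite: NeukirchANT1999, Ch. II Prop. (8.5)] -/
theorem sum_haarCapsuleWeight_mul_prod_erase (α : A) (g : placesOver F p → ℝ) :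
    ∑ vA : A → placesOver F p,
        haarCapsuleWeight F A * ((∏ β ∈ Finset.univ.erase α, (localDeg F (vA β).1 : ℝ)) * g (vA α)) =
      ∑ w : placesOver F p, 1 / (Module.finrank ℚ F : ℝ) * g w := by
  have hd : (Module.finrank ℚ F : ℝ) ≠ 0 := (FinDivisor.finrank_pos (F := F)).ne'
  have hA : 1 ≤ Fintype.card A := Fintype.card_pos
  have hpow : (Module.finrank ℚ F : ℝ) ^ Fintype.card A =
      (Module.finrank ℚ F : ℝ) ^ (Fintype.card A - 1) * Module.finrank ℚ F := by
    rw [← pow_succ, Nat.sub_add_cancel hA]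
  rw [← Finset.mul_sum, sum_prod_erase_localDeg_mul, ← Finset.mul_sum, ← mul_assoc, haarCapsuleWeight, hpow]
  congr 1
  field_simp

/-- **The local law at `p`**: `μ^log_{A,p}((α,f)·T) = μ^log_{A,p}(T) + Σ_{v|p} (1/[F:ℚ])·log‖f‖_v` — the capsule
packet moves by exactly the single-label packet change of abc-iut-L6-d3 (`packetLogModulus`, up to the indexing
of the packet by `V(F)_p`). [claim: Mochizuki2012, status: disputed] -/
theorem nonarchCapsuleLogVolume_act (α : A) (f : Fˣ) (T : NonarchCapsuleRegion F A p) :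
    nonarchCapsuleLogVolume F A p (nonarchCapsuleAct F A p α f T) =
      nonarchCapsuleLogVolume F A p T +
        ∑ w : placesOver F p, 1 / (Module.finrank ℚ F : ℝ) *
          Real.log (NumberField.HeightOneSpectrum.adicAbv F w.1 (f : F) : ℝ) := by
  have h := sum_haarCapsuleWeight_mul_prod_erase F A p α
    (fun w => Real.log (NumberField.HeightOneSpectrum.adicAbv F w.1 (f : F) : ℝ))
  simp only [nonarchCapsuleLogVolume, nonarchCapsuleAct, padicPortionLogVol_act, mul_add, Finset.sum_add_distrib]
  rw [h]

end Nonarch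

end Literature.IUT.LogThetaLattice

end
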